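/-
Copyright (c) 2026 the pub-hodgecm-mathlib formalisation cell (harness21).  Prover seat hodgecm-mathlib-K2Liu-p10 (g2), Track B «K2-LIT»,
#184♮ = hLiu418 = `stmt-HodgeConjecture-24832`; SIGS-RoadI-v3 §Hol row H1-C (sequel for the adelic Hol.3(c) assembly `K2LiuHolFourierRigidityOfResidue`:
the frame image of the Weyl element `w_Δ = ι(1,−1)`).  THEOREMS ONLY (no `def`, no `instance`, no named-fact hypothesis, no `sorry`).
-/
import Summits.HodgeConjecture.HodgeConjecture.Theorems.K2LiuHermitianTubeFrameArchInv
import HarnessLib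

/-!
# Crux `HLiu418`, Road I, organ Hol-1 (H1-C), Weyl clause: the tube frame carries `w_Δ = ι(1, −1) = diag(1, −1)` to an
# ANTI-DIAGONAL element `(0 B; C 0)` of `U(J)` with `C` invertible — so its automorphy factor `det(C Z)` is a non-constant cocycle

Cell `hodgecm-mathlib`, crux item hLiu418 = `stmt-HodgeConjecture-24832` (helper lane, count-neutral).  Sequel of ★ `K2LiuHermitianTubeFrame`
(ring-level letters `T = (D D; C₀ −C₀)`, `T⁻¹ = (P₀ −P₁; P₀ P₁)` under (R1) `DP₀ + DP₀ = 1`, (R2) `C₀P₁ + C₀P₁ = −1`, (R3), (R4)), ★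
`K2LiuHermitianTubeFrameArch` (`exists_tubeFrame_arch`) and ★ `K2LiuHermitianTubeFrameArchInv` (`exists_tubeFrame_arch₂`, surjectivity).
* §1 (letters, no relation needed) `frame_mul_blockDiag_mul_frameInv`: `T · diag(1, −1) · T⁻¹ = (0, −(DP₁ + DP₁); C₀P₀ + C₀P₀, 0)` — the
  diagonal blocks cancel IDENTICALLY; under (R1)(R2) the lower-left block `C₀P₀ + C₀P₀ = C₀ (P₀ + P₀)` has unit determinant
  (`isUnit_det_weylBlock`: `(D + D) P₀ = 1` and `C₀ (−(P₁ + P₁)) = 1` make `P₀`, `C₀` invertible).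
* §2 `exists_tubeFrame₃`: the ring package ★ `exists_tubeFrame` for ONE frame PLUS (vii) `∃ B C, IsUnit C.det ∧ T · diag(1,−1) · T⁻¹ = (0 B; C 0)`.
* §3 **`exists_tubeFrame_arch₃ (hw) (hdV0) (hdW0)`**: every conjunct of ★ `exists_tubeFrame_arch₂` (i)–(vi) for ONE per-place frame
  `(T_w, T_w⁻¹)` PLUS (vii) — what the adelic Hol.3(c) sentence consumes: `w_Δ ∈ H(L⁺)` (★ `weylDelta_mem_ratH`) has block matrix
  `diag(1, −1)` (★ `blk_weylDelta`), so its tube image at every complex place is `(0 B_w; C_w 0)` and its cocycle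
  `∏_w det(C_w Z_w)^{k_w}` is non-constant on `ℌ_n^σ` as soon as some `k_w ≠ 0` (★ `K2LiuHolTubeRigidity.exists_det_zpow_prod_ne`).
Sources: [Shimura1997, §§5–6 (Case UT: the Cayley frame and the inversion)]; [GelbartPiatetskishapiroRallis1987, Part A §1 (`w_Δ`)].
HONEST LABEL.  Helper lemmas, count-neutral; `HC_CM` is proved only modulo the 7 printed citations (2 remaining named inputs:
hLiu418 = `stmt-HodgeConjecture-24832`, h413 = `stmt-HodgeConjecture-24833`) until rung 0 closes.
-/

set_option autoImplicit false
set_option linter.dupNamespace false -- the mandated namespace repeats `HodgeConjecture.HodgeConjecture`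

namespace Summit.HodgeConjecture.HodgeConjecture.Cruxes.HLiu418.K2LiuHermitianTubeFrameWeyl

open Matrix Complex NumberField
open scoped MatrixGroups ComplexConjugate
open Literature.NumberTheory.Automorphic Literature.NumberTheory.Automorphic.UnitaryGroup
open Literature.NumberTheory.GelbartRogawski1991 Literature.NumberTheory.GelbartRogawski1991.GRConstruction
open K2LiuHermitianTubeCocycle K2LiuHermitianTubeFrame K2LiuHermitianTubeFrameArch K2LiuHermitianTubeFrameArchInv
  K2LiuSiegelUnipotentLocalDefs

/-! ## 1. Letters: the image of `diag(1, −1)` -/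

section Letters

variable {l : Type*} [Fintype l] [DecidableEq l]

/-- **`T · diag(1, −1) · T⁻¹ = (0, −(DP₁ + DP₁); C₀P₀ + C₀P₀, 0)`** for the letters `T = (D D; C₀ −C₀)`, `T⁻¹ = (P₀ −P₁; P₀ P₁)`
(no relation needed: the diagonal blocks cancel identically). [cite: Shimura1997, §6.4] -/
theorem frame_mul_blockDiag_mul_frameInv (D C₀ P₀ P₁ : Matrix l l ℂ) :
    fromBlocks D D C₀ (-C₀) * fromBlocks 1 0 0 (-1) * fromBlocks P₀ (-P₁) P₀ P₁ =
      fromBlocks 0 (-(D * P₁ + D * P₁)) (C₀ * P₀ + C₀ * P₀) 0 := by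
  rw [fromBlocks_multiply, fromBlocks_multiply]
  congr 1 <;> noncomm_ring

/-- Under (R1) `DP₀ + DP₀ = 1` and (R2) `C₀P₁ + C₀P₁ = −1` the block `C₀P₀ + C₀P₀` has unit determinant. [cite: Shimura1997, §6.4] -/
theorem isUnit_det_weylBlock {D C₀ P₀ P₁ : Matrix l l ℂ} (h1 : D * P₀ + D * P₀ = 1) (h2 : C₀ * P₁ + C₀ * P₁ = -1) :
    IsUnit (C₀ * P₀ + C₀ * P₀).det := by
  have hP₀ : IsUnit P₀.det := by
    refine Matrix.isUnit_det_of_left_inverse (B := D + D) ?_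
    rw [Matrix.add_mul, h1]
  have hC₀ : IsUnit C₀.det := by
    refine Matrix.isUnit_det_of_right_inverse (B := -(P₁ + P₁)) ?_
    rw [Matrix.mul_neg, Matrix.mul_add, h2, neg_neg]
  have h : C₀ * P₀ + C₀ * P₀ = C₀ * (P₀ + P₀) := by rw [Matrix.mul_add]
  rw [h, det_mul]
  refine hC₀.mul ?_
  have h2P : P₀ + P₀ = (2 : ℂ) • P₀ := by rw [two_smul]
  rw [h2P, det_smul]
  exact (IsUnit.pow _ (isUnit_iff_ne_zero.2 two_ne_zero)).mul hP₀

end Letters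

/-! ## 2. The ring-level package with the Weyl clause -/

section Ring

variable {l : Type*} [Fintype l] [DecidableEq l]

/-- **THE FRAME PACKAGE WITH THE WEYL CLAUSE (ring level).**  ★ `exists_tubeFrame` for ONE frame `(T, T⁻¹)` and, in addition,
(vii) `T · diag(1, −1) · T⁻¹ = (0 B; C 0)` with `IsUnit C.det`. [cite: Shimura1997, §§5–6] -/
theorem exists_tubeFrame₃ (t : l → ℝ) (ht : ∀ i, t i ≠ 0) :
    ∃ T Tinv : Matrix (l ⊕ l) (l ⊕ l) ℂ, T * Tinv = 1 ∧ Tinv * T = 1 ∧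
      Tᴴ * (I • Matrix.J l ℂ) * T = fromBlocks (diagonal fun i => (t i : ℂ)) 0 0 (-diagonal fun i => (t i : ℂ)) ∧
      (∀ g : Matrix (l ⊕ l) (l ⊕ l) ℂ, g.toBlocks₁₁ + g.toBlocks₁₂ = g.toBlocks₂₁ + g.toBlocks₂₂ →
        (T * g * Tinv).toBlocks₂₁ = 0) ∧
      (∀ φ : Matrix l l ℂ, ∃ b : Matrix l l ℂ, T * fromBlocks (1 + φ) (-φ) φ (1 - φ) * Tinv = fromBlocks 1 b 0 1 ∧
        ((diagonal (fun i => (t i : ℂ)) * φ)ᴴ = -(diagonal (fun i => (t i : ℂ)) * φ) → bᴴ = b)) ∧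
      (∀ b : Matrix l l ℂ, bᴴ = b → ∃ φ : Matrix l l ℂ, (diagonal (fun i => (t i : ℂ)) * φ)ᴴ = -(diagonal (fun i => (t i : ℂ)) * φ) ∧
        T * fromBlocks (1 + φ) (-φ) φ (1 - φ) * Tinv = fromBlocks 1 b 0 1) ∧
      (∃ B C : Matrix l l ℂ, IsUnit C.det ∧ T * fromBlocks 1 0 0 (-1) * Tinv = fromBlocks 0 B C 0) := by
  -- the letters (as in ★ `exists_tubeFrame`)
  have hd : ∀ i, Real.sqrt (|t i| / 2) ≠ 0 := fun i => (letters_of t ht i).1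
  have he : ∀ i, t i / |t i| * (t i / |t i|) = 1 := fun i => (letters_of t ht i).2.1
  have ht' : ∀ i, 2 * (t i / |t i|) * Real.sqrt (|t i| / 2) * Real.sqrt (|t i| / 2) = t i := fun i => (letters_of t ht i).2.2
  have R1 := letters_R1 (fun i => Real.sqrt (|t i| / 2)) hd
  have R2 := letters_R2 (fun i => Real.sqrt (|t i| / 2)) (fun i => t i / |t i|) hd he
  have R3 := letters_R3 (fun i => Real.sqrt (|t i| / 2)) (fun i => t i / |t i|) hd he
  have R4 := letters_R4 (fun i => Real.sqrt (|t i| / 2)) (fun i => t i / |t i|) hd he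
  refine ⟨_, _, frame_mul_frameInv R1 R2, frameInv_mul_frame R3 R4,
    frame_conjTranspose_mul_smul_J_mul _ _ t ht', fun g hg => toBlocks₂₁_conj_eq_zero_of_siegel _ _ _ _ hg,
    fun φ => ⟨_, conj_unip_eq_transl R1 R2 φ, fun hφ => ?_⟩, fun b hb => ⟨_, skew_phi_of_transl _ _ hd he t ht' hb, ?_⟩,
    ⟨_, _, isUnit_det_weylBlock R1 R2, frame_mul_blockDiag_mul_frameInv _ _ _ _⟩⟩
  · have h := conjTranspose_transl_of_skew (fun i => Real.sqrt (|t i| / 2)) (fun i => t i / |t i|) hd he t ht' hφ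
    simp only [conjTranspose_neg, conjTranspose_add, h]
  · rw [conj_unip_eq_transl R1 R2, frame_phi_of_transl _ _ hd he]
    congr 1
    rw [← add_smul, ← add_smul, ← neg_smul]
    norm_num

end Ring

/-! ## 3. The per-place package with the Weyl clause -/

variable (L : Type) [Field L] [NumberField L] [IsCMField L] {N M n : ℕ} (e : Fin N × Fin M ≃ Fin n)
  (dV : Fin N → L) (hdV : ∀ i, IsCMField.complexConj L (dV i) = dV i)
  (dW : Fin M → L) (hdW : ∀ i, IsCMField.complexConj L (dW i) = dW i)
  (w : {w : InfinitePlace L // w.IsComplex})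

/-- **THE PER-PLACE FRAME PACKAGE WITH THE WEYL CLAUSE.**  As ★ `exists_tubeFrame_arch₂` — for ONE frame `(T, T⁻¹)`: (i)(ii) inverse,
(iii) `archLocal … w ↦ {Pᴴ J P = J}`, Siegel `↦ {C = 0}`, (iv) `IsUnipM ↦` hermitian translation, (iv′) every hermitian translation reached,
(vi) surjectivity onto `{Pᴴ J P = J}` — PLUS (vii) `∃ B C, IsUnit C.det ∧ T · diag(1, −1) · T⁻¹ = (0 B; C 0)` (the tube image of
`w_Δ = ι(1, −1)`, ★ `blk_weylDelta`). [cite: Shimura1997, §§5–6] [cite: GelbartPiatetskishapiroRallis1987, Part A §1] -/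
theorem exists_tubeFrame_arch₃ (hw : IsCMField.complexConj L • w.1 = w.1) (hdV0 : ∀ i, dV i ≠ 0) (hdW0 : ∀ j, dW j ≠ 0) :
    ∃ T Tinv : Matrix (Fin n ⊕ Fin n) (Fin n ⊕ Fin n) ℂ, T * Tinv = 1 ∧ Tinv * T = 1 ∧
      (∀ g : GL (Fin (n + n)) ℂ, g ∈ archLocal L (n + n) (hermD L e dV hdV dW hdW) w →
        (T * Matrix.reindex (e₂ (n := n)).symm (e₂ (n := n)).symm (g : Matrix _ _ ℂ) * Tinv)ᴴ * Matrix.J (Fin n) ℂ *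
          (T * Matrix.reindex (e₂ (n := n)).symm (e₂ (n := n)).symm (g : Matrix _ _ ℂ) * Tinv) = Matrix.J (Fin n) ℂ) ∧
      (∀ g : GL (Fin (n + n)) ℂ, IsSiegelM (n := n) (g : Matrix (Fin (n + n)) (Fin (n + n)) ℂ) →
        (T * Matrix.reindex (e₂ (n := n)).symm (e₂ (n := n)).symm (g : Matrix _ _ ℂ) * Tinv).toBlocks₂₁ = 0) ∧
      (∀ u : GL (Fin (n + n)) ℂ, u ∈ archLocal L (n + n) (hermD L e dV hdV dW hdW) w → IsUnipM (n := n) (u : Matrix (Fin (n + n)) (Fin (n + n)) ℂ) →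
        ∃ b : Matrix (Fin n) (Fin n) ℂ, bᴴ = b ∧
          T * Matrix.reindex (e₂ (n := n)).symm (e₂ (n := n)).symm (u : Matrix _ _ ℂ) * Tinv = fromBlocks 1 b 0 1) ∧
      (∀ b : Matrix (Fin n) (Fin n) ℂ, bᴴ = b → ∃ u : GL (Fin (n + n)) ℂ,
        u ∈ archLocal L (n + n) (hermD L e dV hdV dW hdW) w ∧ IsUnipM (n := n) (u : Matrix (Fin (n + n)) (Fin (n + n)) ℂ) ∧
          T * Matrix.reindex (e₂ (n := n)).symm (e₂ (n := n)).symm (u : Matrix _ _ ℂ) * Tinv = fromBlocks 1 b 0 1) ∧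
      (∀ P : Matrix (Fin n ⊕ Fin n) (Fin n ⊕ Fin n) ℂ, Pᴴ * Matrix.J (Fin n) ℂ * P = Matrix.J (Fin n) ℂ →
        ∃ g : GL (Fin (n + n)) ℂ, g ∈ archLocal L (n + n) (hermD L e dV hdV dW hdW) w ∧
          T * Matrix.reindex (e₂ (n := n)).symm (e₂ (n := n)).symm (g : Matrix _ _ ℂ) * Tinv = P) ∧
      (∃ B C : Matrix (Fin n) (Fin n) ℂ, IsUnit C.det ∧ T * fromBlocks 1 0 0 (-1) * Tinv = fromBlocks 0 B C 0) := by
  obtain ⟨T, Tinv, h1, h2, hT, hS, hU, hB, hW⟩ :=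
    exists_tubeFrame₃ (fun k => (w.1.embedding (dV (e.symm k).1 * dW (e.symm k).2)).re) (tw_ne_zero L e dV hdV dW hdW w hw hdV0 hdW0)
  refine ⟨T, Tinv, h1, h2, fun g hg => ?_, fun g hg => hS _ hg, fun u hu hU' => ?_, fun b hb => ?_, fun P hP => ?_, hW⟩
  · exact conj_mem_UJ hT h1 ((mem_archLocal_hermD_iff L e dV hdV dW hdW w hw g).1 hg)
  · have hshape := (isUnip_blocks_iff _).1 hU'
    set φ := (Matrix.reindex (e₂ (n := n)).symm (e₂ (n := n)).symm (u : Matrix _ _ ℂ)).toBlocks₂₁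
    obtain ⟨b, hb, hherm⟩ := hU φ
    refine ⟨b, hherm ?_, by rw [hshape]; exact hb⟩
    have hmem := (mem_archLocal_hermD_iff L e dV hdV dW hdW w hw u).1 hu
    rw [hshape] at hmem
    exact (unip_conjTranspose_mul_form_mul_iff (by rw [diagonal_conjTranspose]; simp [Pi.star_def]) φ).1 hmem
  · obtain ⟨φ, hskew, hφ⟩ := hB b hb
    have hunit : (fromBlocks (1 + φ) (-φ) φ (1 - φ))ᴴ *
        fromBlocks (diagonal fun k => (((w.1.embedding (dV (e.symm k).1 * dW (e.symm k).2)).re : ℝ) : ℂ)) 0 0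
          (-diagonal fun k => (((w.1.embedding (dV (e.symm k).1 * dW (e.symm k).2)).re : ℝ) : ℂ)) *
        fromBlocks (1 + φ) (-φ) φ (1 - φ) = _ :=
      (unip_conjTranspose_mul_form_mul_iff (by rw [diagonal_conjTranspose]; simp [Pi.star_def]) φ).2 hskew
    let U : Matrix (Fin (n + n)) (Fin (n + n)) ℂ := Matrix.reindex (e₂ (n := n)) (e₂ (n := n)) (fromBlocks (1 + φ) (-φ) φ (1 - φ))
    let Uinv : Matrix (Fin (n + n)) (Fin (n + n)) ℂ :=
      Matrix.reindex (e₂ (n := n)) (e₂ (n := n)) (fromBlocks (1 - φ) φ (-φ) (1 + φ))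
    have hUU : U * Uinv = 1 := by
      show Matrix.reindex _ _ _ * Matrix.reindex _ _ _ = 1
      rw [reindex_apply, reindex_apply, submatrix_mul_equiv, unip_mul_unip_neg, submatrix_one_equiv]
    have hUU' : Uinv * U = 1 := by
      show Matrix.reindex _ _ _ * Matrix.reindex _ _ _ = 1
      rw [reindex_apply, reindex_apply, submatrix_mul_equiv, unip_neg_mul_unip, submatrix_one_equiv]
    refine ⟨⟨U, Uinv, hUU, hUU'⟩, ?_, isUnipM_reindex_unip φ, ?_⟩
    · rw [mem_archLocal_hermD_iff L e dV hdV dW hdW w hw]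
      show (Matrix.reindex _ _ U)ᴴ * _ * Matrix.reindex _ _ U = _
      simp only [U, reindex_symm_reindex]
      exact hunit
    · show T * Matrix.reindex _ _ U * Tinv = _
      simp only [U, reindex_symm_reindex]
      exact hφ
  · -- surjectivity: `g̃ = Tinv P T`, inverse `Tinv (−J Pᴴ J) T` (as in ★ `exists_tubeFrame_arch₂`)
    let G : Matrix (Fin (n + n)) (Fin (n + n)) ℂ := Matrix.reindex (e₂ (n := n)) (e₂ (n := n)) (Tinv * P * T)
    let Ginv : Matrix (Fin (n + n)) (Fin (n + n)) ℂ :=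
      Matrix.reindex (e₂ (n := n)) (e₂ (n := n)) (Tinv * -(Matrix.J (Fin n) ℂ * Pᴴ * Matrix.J (Fin n) ℂ) * T)
    have hGG : G * Ginv = 1 := by
      show Matrix.reindex _ _ _ * Matrix.reindex _ _ _ = 1
      rw [reindex_apply, reindex_apply, submatrix_mul_equiv, show Tinv * P * T * (Tinv * -(Matrix.J (Fin n) ℂ * Pᴴ * Matrix.J (Fin n) ℂ) * T) =
        Tinv * (P * ((T * Tinv) * -(Matrix.J (Fin n) ℂ * Pᴴ * Matrix.J (Fin n) ℂ))) * T by simp only [Matrix.mul_assoc], h1, Matrix.one_mul,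
        mul_neg_J_conjTranspose_J hP, Matrix.mul_one, h2, submatrix_one_equiv]
    have hGG' : Ginv * G = 1 := by
      show Matrix.reindex _ _ _ * Matrix.reindex _ _ _ = 1
      rw [reindex_apply, reindex_apply, submatrix_mul_equiv, show Tinv * -(Matrix.J (Fin n) ℂ * Pᴴ * Matrix.J (Fin n) ℂ) * T * (Tinv * P * T) =
        Tinv * (-(Matrix.J (Fin n) ℂ * Pᴴ * Matrix.J (Fin n) ℂ) * ((T * Tinv) * P)) * T by simp only [Matrix.mul_assoc], h1, Matrix.one_mul,
        neg_J_conjTranspose_J_mul hP, Matrix.mul_one, h2, submatrix_one_equiv]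
    refine ⟨⟨G, Ginv, hGG, hGG'⟩, ?_, ?_⟩
    · rw [mem_archLocal_hermD_iff L e dV hdV dW hdW w hw]
      show (Matrix.reindex _ _ G)ᴴ * _ * Matrix.reindex _ _ G = _
      simp only [G, reindex_symm_reindex]
      exact inv_conj_preserves hT h1 h2 hP
    · show T * Matrix.reindex _ _ G * Tinv = P
      simp only [G, reindex_symm_reindex]
      rw [show T * (Tinv * P * T) * Tinv = (T * Tinv) * P * (T * Tinv) by simp only [Matrix.mul_assoc], h1, Matrix.one_mul,
        Matrix.mul_one]

end Summit.HodgeConjecture.HodgeConjecture.Cruxes.HLiu418.K2LiuHermitianTubeFrameWeyl
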